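import Summits.CriticalPhenomena.PercolationContinuityZ3.Theorems.Transplant.HexShadowRouting
import Summits.CriticalPhenomena.PercolationContinuityZ3.Theorems.Transplant.HexShadowRoutingNode
import HarnessLib

/-!
# HEXAGONAL SHADOWS XXXIV — THE ROUTING NODE FROM LOCAL LINKAGE: `LocalLinkage → HexLocatedSurgeries → HexGluing`; the film rows modulo `LocalLinkage`

builds on p205010 (kernel theorem, internal audit signed; external expert review pending) — NOT used in this file.  Lane `prim-bschramm`, seat
`prim-bschramm-p2` (gen 33; class C1b; memo `HOME/bschramm/P2-LATTICES.md` §120); helper file (`--supports stmt-CriticalPhenomena-4575 --as helper`).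
Slab original: the Fact-2 assembly `SlabGluingFact2.lean` (counting the excluded points `zBad ∪ lastBad`).
* §1 **`hexLocatedSurgeries_of_localLinkage`**: located surgeries of radius `3` at all but `N₀ = 1429` points of `U(ω)` (the exceptional sets `X₁`, `X₂`, `zBad` and
  the `3`-neighbourhood of the end of `γ_min(ω)` lie in five lattice hexagons of radii `3, 4, 12, 12, 3`), hence **`hexGluing_of_localLinkage`**: DST's Gluing
  Lemma 6 in hexagonal geometry holds for every graph with a hexagonal shadow satisfying the purely local, key-free node `LocalLinkage`;
* §2 the two film rows modulo `LocalLinkage`: **`slab111OwnCriticalContinuity_of_localLinkage`** (every `k ≥ 1`) and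
  **`TriFilm.theta_criticalProb_eq_zero_of_localLinkage`** (every `k`).
[cite: DuminilCopinSidoraviciusTassion2016, Lemma 6 and §2.3 (proof of Fact 2, pp. 6–7)] [cite: BenjaminiSchramm1996, Conj. 4 / Question 3]
-/

noncomputable section

namespace Summit.CriticalPhenomena.PercolationContinuityZ3.Theorems.Transplant

open MeasureTheory Literature.Probability.Percolation Literature.Probability.LatticeModels SimpleGraph Filter
open scoped Classical Topology

namespace HexShadow

variable {V : Type} {G : SimpleGraph V} (Φ : HexShadow G) [Countable V]

/-! ## §1 The node from local linkage -/

/-- Counting in a filtered finset through a bounded hexagon. [folklore] -/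
private theorem card_filter_le_of_subset_hexBall (T : Finset (Site 2)) (p : Site 2 → Prop) (q : Site 2) (R : ℕ)
    (h : ∀ z ∈ T, p z → z ∈ hexBall q R) : (T.filter p).card ≤ (2 * R + 1) ^ 2 := by
  refine (Finset.card_le_card ?_).trans (card_filter_mem_hexBall_le T q R)
  intro z hz
  rw [Finset.mem_filter] at hz ⊢
  exact ⟨hz.1, h z hz.1 hz.2⟩

/-- **THE ROUTING NODE FROM LOCAL LINKAGE** (DST 2016, §2.3, proof of Fact 2, with the instance's "three disjoint paths" in the swap-pair form
`LocalLinkage`): located surgery outputs of radius `3` exist at all but at most `1429` points of `U(ω)`, for all data in range with `m ≥ 7` and every lattice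
configuration `ω ∈ 𝒳`. [cite: DuminilCopinSidoraviciusTassion2016, §2.3 (proof of Fact 2, pp. 6–7)] -/
theorem hexLocatedSurgeries_of_localLinkage (hL : Φ.LocalLinkage) : Φ.HexLocatedSurgeries := by
  refine ⟨3, (2 * 3 + 1) ^ 2 + (2 * 4 + 1) ^ 2 + ((2 * 12 + 1) ^ 2 + (2 * 12 + 1) ^ 2) + (2 * 3 + 1) ^ 2, 7, fun Γ hm hΓ ω hω hX => ?_⟩
  have hA : ω ∈ Φ.evA Γ := hX.1.1.1
  obtain ⟨hγO, -⟩ := Φ.γmin_spec Γ hA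
  set v₀ : V := (Φ.γmin Γ ω).getLast hγO.ne_nil with hv₀
  have hlast : (Φ.γmin Γ ω).getLast? = some v₀ := List.getLast?_eq_some_getLast hγO.ne_nil
  set T : Finset (Site 2) := (Φ.U_finite Γ ω).toFinset with hT
  have hTU : ∀ z, z ∈ T ↔ z ∈ Φ.U Γ ω := fun z => Set.Finite.mem_toFinset _
  set good : Site 2 → Prop := fun z => z ∉ Φ.X₁ Γ ∧ z ∉ Φ.X₂ Γ ∧ z ∉ Φ.zBad Γ ∧ ∀ v ∈ (Φ.γmin Γ ω).getLast?, z ∉ hexBall (Φ.sh v) 3 with hgood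
  have hbs : ∀ z ∈ T, z ∈ Φ.big Γ ∧ z ∈ Φ.small Γ := by
    intro z hz
    obtain ⟨hzs, ⟨g, hg, hgz⟩, -⟩ := (hTU z).1 hz
    exact ⟨hgz ▸ hγO.subset g hg, hzs⟩
  refine ⟨T.filter good, fun z hz => (hTU z).1 (Finset.mem_filter.1 hz).1, ?_, ?_⟩
  · -- counting the excluded points
    rw [Set.ncard_eq_toFinset_card _ (Φ.U_finite Γ ω), ← Finset.card_filter_add_card_filter_not good]
    change (T.filter good).card + (T.filter fun z => ¬good z).card ≤ (T.filter good).card + _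
    have hsub : (T.filter fun z => ¬good z) ⊆ T.filter (· ∈ Φ.X₁ Γ) ∪ T.filter (· ∈ Φ.X₂ Γ) ∪
        (T.filter (· ∈ hexBall (Φ.centre + ![6 * (Γ.m : ℤ), Φ.period * Γ.s - Γ.m - Γ.a]) 12) ∪
          T.filter (· ∈ hexBall (Φ.centre + ![6 * (Γ.m : ℤ), Φ.period * Γ.s - Γ.m + Γ.a]) 12)) ∪ T.filter (· ∈ hexBall (Φ.sh v₀) 3) := by
      intro z hz
      rw [Finset.mem_filter] at hz
      obtain ⟨hzT, hng⟩ := hz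
      simp only [hgood, not_and_or, not_not, not_forall, exists_prop] at hng
      simp only [Finset.mem_union, Finset.mem_filter]
      rcases hng with h | h | h | ⟨v, hv, h⟩
      · exact Or.inl (Or.inl (Or.inl ⟨hzT, h⟩))
      · exact Or.inl (Or.inl (Or.inr ⟨hzT, h⟩))
      · rcases zBad_subset h with h' | h'
        · exact Or.inl (Or.inr (Or.inl ⟨hzT, h'⟩))
        · exact Or.inl (Or.inr (Or.inr ⟨hzT, h'⟩))
      · right
        rw [hlast] at hv
        simp only [Option.mem_def, Option.some.injEq] at hv
        subst hv
        exact ⟨hzT, h⟩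
    have h1 : (T.filter (· ∈ Φ.X₁ Γ)).card ≤ (2 * 3 + 1) ^ 2 :=
      card_filter_le_of_subset_hexBall T _ _ 3 fun z hz hX => X₁_subset hX (hbs z hz).1 (hbs z hz).2
    have h2 : (T.filter (· ∈ Φ.X₂ Γ)).card ≤ (2 * 4 + 1) ^ 2 :=
      card_filter_le_of_subset_hexBall T _ _ 4 fun z hz hX => X₂_subset hX (hbs z hz).1
    have h3 : (T.filter (· ∈ hexBall (Φ.centre + ![6 * (Γ.m : ℤ), Φ.period * Γ.s - Γ.m - Γ.a]) 12)).card ≤ (2 * 12 + 1) ^ 2 :=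
      card_filter_le_of_subset_hexBall T _ _ 12 fun z _ h => h
    have h4 : (T.filter (· ∈ hexBall (Φ.centre + ![6 * (Γ.m : ℤ), Φ.period * Γ.s - Γ.m + Γ.a]) 12)).card ≤ (2 * 12 + 1) ^ 2 :=
      card_filter_le_of_subset_hexBall T _ _ 12 fun z _ h => h
    have h5 : (T.filter (· ∈ hexBall (Φ.sh v₀) 3)).card ≤ (2 * 3 + 1) ^ 2 := card_filter_le_of_subset_hexBall T _ _ 3 fun z _ h => h
    have := (Finset.card_le_card hsub).trans ((Finset.card_union_le _ _).trans (add_le_add ((Finset.card_union_le _ _).trans (add_le_add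
      ((Finset.card_union_le _ _).trans (add_le_add h1 h2)) ((Finset.card_union_le _ _).trans (add_le_add h3 h4)))) h5))
    omega
  · -- the surgery at a good point
    intro z hz
    obtain ⟨hzT, hg⟩ := Finset.mem_filter.1 hz
    obtain ⟨sg, hsg⟩ := exists_surgery_of_localLinkage hL hΓ hm hω hX ((hTU z).1 hzT) hg.1 hg.2.1 hg.2.2.1 hg.2.2.2
    exact ⟨sg.newConfig, sg.surgOut hX hsg⟩

/-- **THE HEXAGONAL GLUING LEMMA FROM LOCAL LINKAGE** (all of DST §2.3 is proved generically; the instance supplies only `LocalLinkage`).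
[cite: DuminilCopinSidoraviciusTassion2016, Lemma 6 and §2.3] -/
theorem hexGluing_of_localLinkage (hL : Φ.LocalLinkage) : Φ.HexGluing := Φ.hexGluing_of_locatedSurgeries (Φ.hexLocatedSurgeries_of_localLinkage hL)

end HexShadow

/-! ## §2 The film rows modulo `LocalLinkage` -/

/-- **THE `(111)`-FILM THEOREM MODULO LOCAL LINKAGE**: for every `k ≥ 1`, local linkage in the clipped unit blocks of the shadow of `F_k = {0 ≤ x₀+x₁+x₂ ≤ k}`
gives `Slab111OwnCriticalContinuity k` (the film dies at its own critical point at every vertex).  Independent of p205010.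
[cite: DuminilCopinSidoraviciusTassion2016, Thm. 1, §2.3] [cite: BenjaminiSchramm1996, Conj. 4 / Question 3] -/
theorem slab111OwnCriticalContinuity_of_localLinkage {k : ℕ} (hk : 1 ≤ k) (h : (Slab111.hexShadow k).LocalLinkage) : Slab111OwnCriticalContinuity k :=
  slab111OwnCriticalContinuity_of_locatedSurgeries hk ((Slab111.hexShadow k).hexLocatedSurgeries_of_localLinkage h)

/-- **THE TRIANGULAR FILMS MODULO LOCAL LINKAGE**: for every `k`, local linkage for the shadow of `𝕋 × {0..k}` gives `θ_v(p_c) = 0` at every vertex.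
[cite: DuminilCopinSidoraviciusTassion2016, Thm. 1, §2.3] [cite: BenjaminiSchramm1996, Conj. 4 / Question 3] -/
theorem TriFilm.theta_criticalProb_eq_zero_of_localLinkage (k : ℕ) (h : (TriFilm.hexShadow k).LocalLinkage) (v : triFilm k) :
    theta (TriFilm.film k) v (criticalProbIOf (TriFilm.film k) v) = 0 :=
  TriFilm.theta_criticalProb_eq_zero_of_locatedSurgeries k ((TriFilm.hexShadow k).hexLocatedSurgeries_of_localLinkage h) v

end Summit.CriticalPhenomena.PercolationContinuityZ3.Theorems.Transplant

end
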